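import Summits.RiemannHypothesis.RiemannHypothesis.Theses.WeilGroundState
import Summits.RiemannHypothesis.RiemannHypothesis.Theorems.WeilGroundStateGroundStatesConvergeToXiStubRePartGroundState
import Summits.RiemannHypothesis.RiemannHypothesis.Theorems.WeilGroundStateGroundStatesConvergeToXiStubEvenWitnessTight
import Summits.RiemannHypothesis.RiemannHypothesis.Theorems.WeilGroundStateGroundStatesConvergeToXiStubRealWitnessTight
import Summits.RiemannHypothesis.RiemannHypothesis.Theorems.WeilGroundStateGroundStatesConvergeToXiStubEnergyCauchy
import Summits.RiemannHypothesis.RiemannHypothesis.Theorems.WeilGroundStateGroundStatesConvergeToXiStubPointwiseOfTightMoments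
import Summits.RiemannHypothesis.RiemannHypothesis.Theorems.WeilGroundStateGroundStatesConvergeToXiStubMomentsOfStrip
import Summits.RiemannHypothesis.RiemannHypothesis.Theorems.WeilGroundStateGroundStatesConvergeToXiStubLocallyUniformOfPointwise
import Summits.RiemannHypothesis.RiemannHypothesis.Theorems.WeilGroundStateGroundStatesConvergeToXiLineExact
import Summits.RiemannHypothesis.RiemannHypothesis.Theorems.WeilGroundStateGroundStatesConvergeToXiLineExactMoments
import Summits.RiemannHypothesis.RiemannHypothesis.Theorems.WeilGroundStateGroundStatesConvergeToXiRHofTightZero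
import HarnessLib

/-!
# `WeilGroundState.GroundStatesConvergeToXi` — the REAL NORMAL FORM of the crux and of the open stub
(crux item stmt-RiemannHypothesis-1527, route route-RiemannHypothesis-WeilGroundState; line `Sketch`,
rev L8, continuation lead c6; `--supports`; RH-free)

The four wave-1 stubs of rev L8 (`stub_rePart_groundState` p150213, `stub_evenWitness_tight`
p148663, `stub_realWitness_tight` p149708, `stub_energyCauchy` p149917) composed:

* `groundStatesConvergeToXi_iff_real_even_pos` — **the crux holds iff it holds with REAL-VALUED
  EVEN ground states and REAL POSITIVE constants**: windows `a_k → ∞`, ground states `u_k`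
  (`IsWeilGroundState (a k) (u k)`) with `u_k(-t) = u_k(t)`, `Im u_k = 0`, and `c_k > 0` real
  with `c_k · weilMellin u_k → riemannXi` locally uniformly on the open critical strip.  This is
  exactly the object class of Connes–van Suijlekom Thm 6.1 / de Branges: for such `u` the
  transform is reflection- and conjugation-symmetric, `û(1 - s) = û(s)`, `û(conj s) = conj û(s)`
  (`weilMellin_one_sub_of_even`, `weilMellin_conj_of_real`), i.e. `U(z) = û(1/2 + iz)` is a real
  entire even function; in particular `û` is real on the critical line and on the real axis
  (`im_weilMellin_criticalLine_eq_zero`, `im_weilMellin_ofReal_eq_zero`).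
* `exists_real_even_tight_cruxWitness` — the same normal form for `(T)`-tight witnesses, with
  tightness transferred (`|Re z| ≤ |z|`, evenness of `e^{b|t|}`).
* `tightMomentLimit_real_iff` — the rev-L8 open stub `A_real` (real even ground states, positive
  constants, (T) tightness, (M) moments) is EQUIVALENT to the rev-L7 stub `A`; hence
  (`tightMomentLimit_real_iff_tight_cruxWitness`) to "∃ (T)-tight crux witness" and to C⁺, and it
  is ≥ RH (`riemannHypothesis_of_tightMomentLimit_real`, via `riemannHypothesis_of_tightWeakLimit`).
* `tendsto_re_weilQuadratic_sub_of_minimizingSeq` — the form-domain handle in its symmetric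
  form: ANY two normalised minimising sequences of the SAME ground state are mutually Cauchy in
  energy, `Re Q(gₙ − hₙ) → 0` (interleave them and apply `stub_energyCauchy`); so the closed-form
  value `lim Re Q` and the energy pairing of a ground state do not depend on the chosen sequence.

No new definitions; Mathlib + landed tree material only; standard axioms.
-/

set_option linter.dupNamespace false

noncomputable section

open scoped Topology Real ComplexConjugate
open Filter Set MeasureTheory Complex

namespace Summit.RiemannHypothesis.RiemannHypothesis.Theorems.GroundStatesConvergeToXi

open Literature.NumberTheory.LFunctions

/-! ### Transform symmetries of real even window functions -/

/-- For an EVEN function the symmetric Mellin–Laplace transform is reflection symmetric: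
`û(1 - s) = û(s)` (`weilMellin_comp_neg`). [folklore] -/
theorem weilMellin_one_sub_of_even {u : ℝ → ℂ} (hev : ∀ t, u (-t) = u t) (s : ℂ) :
    weilMellin u (1 - s) = weilMellin u s := by
  rw [← weilMellin_comp_neg u s]
  exact congrArg (fun f : ℝ → ℂ => weilMellin f s) (funext fun t => (hev t).symm).symm

/-- For a REAL-VALUED function the transform is conjugation symmetric:
`û(conj s) = conj û(s)` (`realWitness_weilMellin_conj` with `conj u = u`). [folklore] -/
theorem weilMellin_conj_of_real {u : ℝ → ℂ} (hre : ∀ t, (u t).im = 0) (s : ℂ) :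
    weilMellin u (conj s) = conj (weilMellin u s) := by
  have hu : (fun t ↦ conj (u t)) = u := funext fun t => Complex.conj_eq_iff_im.2 (hre t)
  have h := realWitness_weilMellin_conj u (conj s)
  rw [hu, Complex.conj_conj] at h
  exact h

/-- A real-valued function has a transform REAL ON THE REAL AXIS: `Im û(σ) = 0` for real `σ`. [folklore] -/
theorem im_weilMellin_ofReal_eq_zero {u : ℝ → ℂ} (hre : ∀ t, (u t).im = 0) (σ : ℝ) :
    (weilMellin u σ).im = 0 := by
  have h := weilMellin_conj_of_real hre (σ : ℂ)
  rw [Complex.conj_ofReal] at h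
  exact Complex.conj_eq_iff_im.1 h.symm

/-- A real-valued EVEN function has a transform REAL ON THE CRITICAL LINE:
`Im û(1/2 + it) = 0` (`conj (1/2 + it) = 1 - (1/2 + it)`; the two symmetries combined).  So for
the real even ground states of the normal form, `U(z) = û(1/2 + iz)` is a real entire even
function — the Hermite–Biehler / de Branges setting of Connes–van Suijlekom Thm 6.1. [folklore] -/
theorem im_weilMellin_criticalLine_eq_zero {u : ℝ → ℂ} (hev : ∀ t, u (-t) = u t)
    (hre : ∀ t, (u t).im = 0) (t : ℝ) :
    (weilMellin u (1 / 2 + t * I)).im = 0 := by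
  have hconj : conj ((1 : ℂ) / 2 + t * I) = 1 - (1 / 2 + t * I) := by
    apply Complex.ext
    · simp; norm_num
    · simp
  have h := weilMellin_conj_of_real hre (1 / 2 + t * I)
  rw [hconj, weilMellin_one_sub_of_even hev] at h
  exact Complex.conj_eq_iff_im.1 h.symm

/-! ### The real normal form of crux witnesses -/

/-- **Real normal form of crux witnesses (RH-free).**  Let `a_k → ∞`, `u_k` ground states at
`a_k` and `c_k` scalars with `c_k · weilMellin u_k → ξ` locally uniformly on the open critical
strip.  Then there is a witness of the same shape with REAL-VALUED EVEN ground states and REAL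
POSITIVE constants (`stub_evenWitness_tight`, then `stub_realWitness_tight` fed with
`stub_rePart_groundState`; the tightness clauses are discarded). [folklore] -/
theorem exists_real_even_pos_cruxWitness {a : ℕ → ℝ} {u : ℕ → ℝ → ℂ} {c : ℕ → ℂ}
    (ha : Tendsto a atTop atTop) (hu : ∀ k, IsWeilGroundState (a k) (u k))
    (hlim : TendstoLocallyUniformlyOn (fun k s => c k * weilMellin (u k) s) riemannXi atTop
      {s : ℂ | 0 < s.re ∧ s.re < 1}) :
    ∃ a' : ℕ → ℝ, ∃ v : ℕ → ℝ → ℂ, ∃ c' : ℕ → ℝ, Tendsto a' atTop atTop ∧ (∀ k, 0 < c' k) ∧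
      (∀ k, IsWeilGroundState (a' k) (v k)) ∧ (∀ k t, v k (-t) = v k t) ∧
      (∀ k t, (v k t).im = 0) ∧
      TendstoLocallyUniformlyOn (fun k s => (c' k : ℂ) * weilMellin (v k) s) riemannXi atTop
        {s : ℂ | 0 < s.re ∧ s.re < 1} := by
  obtain ⟨a₁, v₁, c₁, ha₁, -, hv₁, hev₁, -, hlim₁⟩ := stub_evenWitness_tight a u c ha hu hlim
  obtain ⟨a₂, v₂, c₂, ha₂, hc₂, hv₂, hev₂, hre₂, -, hlim₂⟩ :=
    stub_realWitness_tight stub_rePart_groundState a₁ v₁ c₁ ha₁ hv₁ hev₁ hlim₁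
  exact ⟨a₂, v₂, c₂, ha₂, hc₂, hv₂, hev₂, hre₂, hlim₂⟩

/-- **Real normal form of the crux (RH-free).**  `GroundStatesConvergeToXi` holds if and only if
it holds with REAL-VALUED EVEN ground states and REAL POSITIVE constants: windows `a_k → ∞`,
ground states `u_k` with `u_k(-t) = u_k(t)` and `Im u_k = 0`, and `c_k > 0` with
`c_k · weilMellin u_k → riemannXi` locally uniformly on the open critical strip — the object class
of Connes–van Suijlekom Thm 6.1 (real even bottom eigenfunctions), whose transforms
`U_k(z) = û_k(1/2 + iz)` are real entire even functions (`im_weilMellin_criticalLine_eq_zero`). [folklore] -/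
theorem groundStatesConvergeToXi_iff_real_even_pos :
    Summit.RiemannHypothesis.RiemannHypothesis.Theses.WeilGroundState.GroundStatesConvergeToXi ↔
      ∃ a : ℕ → ℝ, ∃ u : ℕ → ℝ → ℂ, ∃ c : ℕ → ℝ, Tendsto a atTop atTop ∧ (∀ k, 0 < c k) ∧
        (∀ k, IsWeilGroundState (a k) (u k)) ∧ (∀ k t, u k (-t) = u k t) ∧
        (∀ k t, (u k t).im = 0) ∧
        TendstoLocallyUniformlyOn (fun k s => (c k : ℂ) * weilMellin (u k) s) riemannXi atTop
          {s : ℂ | 0 < s.re ∧ s.re < 1} := by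
  constructor
  · rintro ⟨a, u, c, ha, hk, hlim⟩
    exact exists_real_even_pos_cruxWitness ha (fun k ↦ ⟨(hk k).2.2.1, (hk k).2.2.2⟩) hlim
  · rintro ⟨a, u, c, ha, hc, hu, -, -, hlim⟩
    exact ⟨a, u, fun k => (c k : ℂ), ha,
      fun k ↦ ⟨(hu k).pos, Complex.ofReal_ne_zero.2 (hc k).ne', (hu k).1, (hu k).2⟩, hlim⟩

/-- **Real normal form of TIGHT crux witnesses (RH-free).**  A `(T)`-tight crux-shaped witness
(tight in every `L¹(e^{b|t|})`, `b < 1/2`) yields a `(T)`-tight crux-shaped witness with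
REAL-VALUED EVEN ground states and REAL POSITIVE constants (tightness transfers through both
normal-form steps: `c'v = (cu + cu(-·))/2`, then `c'v = Re(cu)` pointwise). [folklore] -/
theorem exists_real_even_tight_cruxWitness {a : ℕ → ℝ} {u : ℕ → ℝ → ℂ} {c : ℕ → ℂ}
    (ha : Tendsto a atTop atTop) (hu : ∀ k, IsWeilGroundState (a k) (u k))
    (htight : ∀ b : ℝ, b < 1 / 2 → ∃ M : ℝ, ∀ k, ∫ t, ‖c k * u k t‖ * Real.exp (b * |t|) ≤ M)
    (hlim : TendstoLocallyUniformlyOn (fun k s => c k * weilMellin (u k) s) riemannXi atTop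
      {s : ℂ | 0 < s.re ∧ s.re < 1}) :
    ∃ a' : ℕ → ℝ, ∃ v : ℕ → ℝ → ℂ, ∃ c' : ℕ → ℝ, Tendsto a' atTop atTop ∧ (∀ k, 0 < c' k) ∧
      (∀ k, IsWeilGroundState (a' k) (v k)) ∧ (∀ k t, v k (-t) = v k t) ∧
      (∀ k t, (v k t).im = 0) ∧
      (∀ b : ℝ, b < 1 / 2 → ∃ M : ℝ, ∀ k, ∫ t, ‖(c' k : ℂ) * v k t‖ * Real.exp (b * |t|) ≤ M) ∧
      TendstoLocallyUniformlyOn (fun k s => (c' k : ℂ) * weilMellin (v k) s) riemannXi atTop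
        {s : ℂ | 0 < s.re ∧ s.re < 1} := by
  obtain ⟨a₁, v₁, c₁, ha₁, -, hv₁, hev₁, ht₁, hlim₁⟩ := stub_evenWitness_tight a u c ha hu hlim
  obtain ⟨a₂, v₂, c₂, ha₂, hc₂, hv₂, hev₂, hre₂, ht₂, hlim₂⟩ :=
    stub_realWitness_tight stub_rePart_groundState a₁ v₁ c₁ ha₁ hv₁ hev₁ hlim₁
  exact ⟨a₂, v₂, c₂, ha₂, hc₂, hv₂, hev₂, hre₂, fun b hb => ht₂ b (ht₁ b (htight b hb)), hlim₂⟩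

/-! ### The open stub in real normal form: exactness and RH-strength -/

/-- **Rev-L8 exactness (RH-free): the real normal form of the open stub loses nothing,
`A_real ⟺ A`.**  `A_real`: `∃ a_k → ∞`, REAL-VALUED EVEN ground states `u_k`, REAL `c_k > 0`
with (T) tightness in every `L¹(e^{b|t|})`, `b < 1/2`, and (M) convergence of all moments
`c_k ∫ u_k tⁿ → ∫ Φ tⁿ`, `Φ(t) = 2Ψ(2t)`; `A`: the same with complex `u_k`, `c_k ≠ 0`.
(⇒) cast the constants; (⇐) transfer by moments to a tight crux witness
(`stub_pointwise_of_tight_moments`, `stub_locallyUniform_of_pointwise`), real even normal form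
(`exists_real_even_tight_cruxWitness`), moments back (`stub_moments_of_strip`). [folklore] -/
theorem tightMomentLimit_real_iff :
    (∃ a : ℕ → ℝ, ∃ u : ℕ → ℝ → ℂ, ∃ c : ℕ → ℝ, Tendsto a atTop atTop ∧ (∀ k, 0 < c k) ∧
      (∀ k, IsWeilGroundState (a k) (u k)) ∧ (∀ k t, u k (-t) = u k t) ∧
      (∀ k t, (u k t).im = 0) ∧
      (∀ b : ℝ, b < 1 / 2 → ∃ M : ℝ, ∀ k, ∫ t, ‖(c k : ℂ) * u k t‖ * Real.exp (b * |t|) ≤ M) ∧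
      (∀ n : ℕ, Tendsto (fun k => (c k : ℂ) * ∫ t, u k t * (t : ℂ) ^ n) atTop
        (𝓝 (∫ t, 2 * LagariasMontague.Psic (2 * t) * (t : ℂ) ^ n)))) ↔
    (∃ a : ℕ → ℝ, ∃ u : ℕ → ℝ → ℂ, ∃ c : ℕ → ℂ, Tendsto a atTop atTop ∧ (∀ k, c k ≠ 0) ∧
      (∀ k, IsWeilGroundState (a k) (u k)) ∧
      (∀ b : ℝ, b < 1 / 2 → ∃ M : ℝ, ∀ k, ∫ t, ‖c k * u k t‖ * Real.exp (b * |t|) ≤ M) ∧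
      (∀ n : ℕ, Tendsto (fun k => c k * ∫ t, u k t * (t : ℂ) ^ n) atTop
        (𝓝 (∫ t, 2 * LagariasMontague.Psic (2 * t) * (t : ℂ) ^ n)))) := by
  constructor
  · rintro ⟨a, u, c, ha, hc, hu, -, -, htight, hmom⟩
    exact ⟨a, u, fun k => (c k : ℂ), ha, fun k => Complex.ofReal_ne_zero.2 (hc k).ne', hu,
      htight, hmom⟩
  · rintro ⟨a, u, c, ha, -, hu, htight, hmom⟩
    obtain ⟨a', v, c', ha', hc', hv, hev, hre, ht', hlim'⟩ :=
      exists_real_even_tight_cruxWitness ha hu htight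
        (stub_locallyUniform_of_pointwise hu htight (stub_pointwise_of_tight_moments hu htight hmom))
    exact ⟨a', v, c', ha', hc', hv, hev, hre, ht', stub_moments_of_strip hv hlim'⟩

/-- **`A_real` is EXACTLY "a (T)-tight witness of the crux"** (RH-free; `tightMomentLimit_real_iff`
and `tightMomentLimit_iff_tight_cruxWitness`, p146342). [folklore] -/
theorem tightMomentLimit_real_iff_tight_cruxWitness :
    (∃ a : ℕ → ℝ, ∃ u : ℕ → ℝ → ℂ, ∃ c : ℕ → ℝ, Tendsto a atTop atTop ∧ (∀ k, 0 < c k) ∧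
      (∀ k, IsWeilGroundState (a k) (u k)) ∧ (∀ k t, u k (-t) = u k t) ∧
      (∀ k t, (u k t).im = 0) ∧
      (∀ b : ℝ, b < 1 / 2 → ∃ M : ℝ, ∀ k, ∫ t, ‖(c k : ℂ) * u k t‖ * Real.exp (b * |t|) ≤ M) ∧
      (∀ n : ℕ, Tendsto (fun k => (c k : ℂ) * ∫ t, u k t * (t : ℂ) ^ n) atTop
        (𝓝 (∫ t, 2 * LagariasMontague.Psic (2 * t) * (t : ℂ) ^ n)))) ↔
    (∃ a : ℕ → ℝ, ∃ u : ℕ → ℝ → ℂ, ∃ c : ℕ → ℂ, Tendsto a atTop atTop ∧ (∀ k, c k ≠ 0) ∧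
      (∀ k, IsWeilGroundState (a k) (u k)) ∧
      (∀ b : ℝ, b < 1 / 2 → ∃ M : ℝ, ∀ k, ∫ t, ‖c k * u k t‖ * Real.exp (b * |t|) ≤ M) ∧
      TendstoLocallyUniformlyOn (fun k s => c k * weilMellin (u k) s) riemannXi atTop
        {s : ℂ | 0 < s.re ∧ s.re < 1}) :=
  tightMomentLimit_real_iff.trans tightMomentLimit_iff_tight_cruxWitness

/-- **The rev-L8 open stub is ≥ RH** (RH-free): `A_real ⇒ RiemannHypothesis`
(`tightMomentLimit_real_iff_tight_cruxWitness`, `tightWeakLimit_iff_tight_cruxWitness` and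
`riemannHypothesis_of_tightWeakLimit`, p136942). [folklore] -/
theorem riemannHypothesis_of_tightMomentLimit_real
    (h : ∃ a : ℕ → ℝ, ∃ u : ℕ → ℝ → ℂ, ∃ c : ℕ → ℝ, Tendsto a atTop atTop ∧ (∀ k, 0 < c k) ∧
      (∀ k, IsWeilGroundState (a k) (u k)) ∧ (∀ k t, u k (-t) = u k t) ∧
      (∀ k t, (u k t).im = 0) ∧
      (∀ b : ℝ, b < 1 / 2 → ∃ M : ℝ, ∀ k, ∫ t, ‖(c k : ℂ) * u k t‖ * Real.exp (b * |t|) ≤ M) ∧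
      (∀ n : ℕ, Tendsto (fun k => (c k : ℂ) * ∫ t, u k t * (t : ℂ) ^ n) atTop
        (𝓝 (∫ t, 2 * LagariasMontague.Psic (2 * t) * (t : ℂ) ^ n)))) :
    RiemannHypothesis :=
  riemannHypothesis_of_tightWeakLimit (tightWeakLimit_iff_tight_cruxWitness.2
    (tightMomentLimit_real_iff_tight_cruxWitness.1 h))

/-! ### The energy pairing of a ground state does not depend on the minimising sequence -/

/-- **Two minimising sequences of the same ground state are mutually Cauchy in energy
(RH-free).**  If `gₙ` and `hₙ` are `L²`-normalised window test sequences with `Re Q → ε(a)`, both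
converging in `L²` to the same `u ∈ L²`, then `Re Q(gₙ − hₙ) → 0`.  Proof: the interleaved
sequence `g₀, h₀, g₁, h₁, …` is again such a sequence, hence Cauchy in energy
(`stub_energyCauchy`); evaluate along the pairs `(2n, 2n+1)`.  Consequently the closed-form
value and the energy pairings `lim B(gₙ, ·)` of an operator-free ground state are intrinsic. [folklore] -/
theorem tendsto_re_weilQuadratic_sub_of_minimizingSeq {a : ℝ} {u : ℝ → ℂ} {g h : ℕ → ℝ → ℂ}
    (hmem : MemLp u 2)
    (hg : ∀ n, IsWeilTest (g n) ∧ tsupport (g n) ⊆ Icc (-a) a ∧ ∫ t, ‖g n t‖ ^ 2 = (1 : ℝ))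
    (hgQ : Tendsto (fun n => (weilQuadratic (g n)).re) atTop (𝓝 (weilGroundEnergy a)))
    (hgL : Tendsto (fun n => ∫ t, ‖g n t - u t‖ ^ 2) atTop (𝓝 0))
    (hh : ∀ n, IsWeilTest (h n) ∧ tsupport (h n) ⊆ Icc (-a) a ∧ ∫ t, ‖h n t‖ ^ 2 = (1 : ℝ))
    (hhQ : Tendsto (fun n => (weilQuadratic (h n)).re) atTop (𝓝 (weilGroundEnergy a)))
    (hhL : Tendsto (fun n => ∫ t, ‖h n t - u t‖ ^ 2) atTop (𝓝 0)) :
    Tendsto (fun n => (weilQuadratic (g n - h n)).re) atTop (𝓝 0) := by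
  -- the interleaved sequence `w (2n) = g n`, `w (2n+1) = h n`
  obtain ⟨w, hw_even, hw_odd, hw⟩ : ∃ w : ℕ → ℝ → ℂ, (∀ n, w (2 * n) = g n) ∧
      (∀ n, w (2 * n + 1) = h n) ∧
      (∀ m, IsWeilTest (w m) ∧ tsupport (w m) ⊆ Icc (-a) a ∧ ∫ t, ‖w m t‖ ^ 2 = (1 : ℝ)) := by
    refine ⟨fun m => if m % 2 = 0 then g (m / 2) else h (m / 2), fun n => ?_, fun n => ?_,
      fun m => ?_⟩
    · have h1 : (2 * n) % 2 = 0 := Nat.mul_mod_right 2 n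
      have h2 : (2 * n) / 2 = n := by omega
      simp only [h1, h2, if_true]
    · have h1 : (2 * n + 1) % 2 = 1 := by omega
      have h2 : (2 * n + 1) / 2 = n := by omega
      simp only [h1, h2, one_ne_zero, if_false]
    · by_cases hm : m % 2 = 0
      · simp only [hm, if_true]
        exact hg _
      · simp only [hm, if_false]
        exact hh _
  -- a real sequence converges if its even- and odd-indexed subsequences converge to the same limit
  have key : ∀ {F : ℕ → ℝ} {L : ℝ}, Tendsto (fun n => F (2 * n)) atTop (𝓝 L) →
      Tendsto (fun n => F (2 * n + 1)) atTop (𝓝 L) → Tendsto F atTop (𝓝 L) := by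
    intro F L h0 h1
    rw [Metric.tendsto_atTop] at h0 h1 ⊢
    intro ε hε
    obtain ⟨N0, hN0⟩ := h0 ε hε
    obtain ⟨N1, hN1⟩ := h1 ε hε
    refine ⟨2 * N0 + 2 * N1 + 1, fun m hm => ?_⟩
    obtain ⟨k, hk | hk⟩ := Nat.even_or_odd' m
    · rw [hk]
      exact hN0 k (by omega)
    · rw [hk]
      exact hN1 k (by omega)
  have hwQ : Tendsto (fun m => (weilQuadratic (w m)).re) atTop (𝓝 (weilGroundEnergy a)) :=
    key (by simpa only [hw_even] using hgQ) (by simpa only [hw_odd] using hhQ)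
  have hwL : Tendsto (fun m => ∫ t, ‖w m t - u t‖ ^ 2) atTop (𝓝 0) :=
    key (by simpa only [hw_even] using hgL) (by simpa only [hw_odd] using hhL)
  have hC := stub_energyCauchy a u w hmem hw hwQ hwL
  -- evaluate along the pairs `(2n, 2n+1) → atTop`
  have h2 : Tendsto (fun n : ℕ => 2 * n) atTop atTop :=
    tendsto_atTop_atTop.2 fun b => ⟨b, fun n hn => by omega⟩
  have h21 : Tendsto (fun n : ℕ => 2 * n + 1) atTop atTop :=
    tendsto_atTop_atTop.2 fun b => ⟨b, fun n hn => by omega⟩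
  have hpair : Tendsto (fun n : ℕ => ((2 * n, 2 * n + 1) : ℕ × ℕ)) atTop atTop := by
    rw [← prod_atTop_atTop_eq]
    exact h2.prodMk h21
  have hlim := hC.comp hpair
  refine hlim.congr fun n => ?_
  simp only [Function.comp_apply, hw_even, hw_odd]

end Summit.RiemannHypothesis.RiemannHypothesis.Theorems.GroundStatesConvergeToXi

end
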